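import Mathlib
import HarnessLib
import Summits.HubbardSuperconductivity.HubbardSuperconductivity.Theorems.KLProgrammeKLRegimeEngineTwoShellLatticeCount
import Literature.MathematicalPhysics.QuantumLattice.HubbardSectorPhaseSpaceCount

/-!
# Route `KLProgramme` — ENGINE child (stmt-HubbardSuperconductivity-20437 `KLRegimeEngineV17F2`): the `1/ρ`-WEIGHTED lattice two-shell mass —
# `Σ_{(ω,k̃) : ω²+e_K(p_k̃)² ≤ Λ′², |e_K(p_{k̃−w̃})| ≤ ε₂} (ω² + e_K(p_k̃)²)^{-1/2}` against the two-shell package, β-UNIFORMLY (no `log β`)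

Cell `gate-hubbard-kl`, seat hubbard-kl-k3c2-p2 g16 (class-#5 STEP supply rows «two-shell / floor», KLTC-INDEX v10.3 §D [k3c2-p2]; companion of
`…EngineTwoShellLatticeCount`).  A soft line of the `D`-weight (or of a running symbol) enters the ph rows of `…MemberDefectRowsMasses` with the value
`|φ(p)|·βL²·‖ĝ_K(p)‖ = |φ(p)|·βL²/ρ(p)`, `ρ = √(ω² + e_K²)`, summed over its disc `ρ ≤ Λ′` AND over the momentum two-shell set cut out by the partner slice line.
The frequency sum of `1/ρ` at fixed `e` is `≍ β·log(Λ′/max(|e|, π/β))`; a flat bound would cost `log(βΛ′)`.  The cure is the elementary layer cake: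
* §1 **`sum_inv_le_dyadic`** — on a finite set with `m ≤ ρ ≤ Λ′ ≤ 2^{I+1}m`: `Σ 1/ρ ≤ Σ_{i ≤ I} (2^{i+1}/Λ′)·#{ρ ≤ Λ′/2^i}` (each point sits in its deepest dyadic
  layer; `Nat.findGreatest`);
* §2 `card_disc_filter_le` — `#{(ω,k̃) : ρ ≤ a ∧ Q(k̃)} ≤ (aβ/π + 3)·#{k̃ : |e_K| ≤ a ∧ Q(k̃)}` (Literature `card_filter_matsubaraFreq_le`);
* §3 **`twoShell_weighted_sum_le`** — for `TwoShellFrameAreaAt A u` and an admissible frame, `0 < Λ′`, `2Λ′ ≤ ε₂`, `ε₂ + Gδ ≤ klE0` (`δ = 2π/L`,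
  `G = 4 + (8/3)Gfr₁U²`), a lattice transfer `w̃` with `0 < r ≤ |p_w̃|_𝕋`:
  `Σ_{ρ(p) ≤ Λ′, |e_K(p_{k̃−w̃})| ≤ ε₂} 1/ρ(p) ≤ (9AL²/(2π²))·((ε₂+Gδ)/r + √(ε₂+Gδ))·[(βΛ′/π)·(10 + 2Gβ/L) + 12Gβ/L]`
  — main term `≍ A·βL²·Λ′·(ε₂/r + √ε₂)` (the `min(·, Λ/|q|)` and `√Λ` slots of the ROOM times the line's phase-space mass `∝ Λ′`), lattice remainders `∝ Gβ/L`
  (harmless under the engine's `L ≥ klEngL₃ β U`); the empty case `Λ′ < π/β` is automatic; `…_klTS` is the package instance.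
Everything is PROVED; no definitions, no named facts; nothing asserts any stub or superconductivity.  [cite: FeldmanSalmhoferTrubowitz1998, App. B]
-/

noncomputable section

namespace Summit.HubbardSuperconductivity.HubbardSuperconductivity.Theorems.EngineV8

set_option linter.dupNamespace false -- summit = problem name (single-conjunct summit), D-0017

open Real Set Finset
open Literature.MathematicalPhysics.QuantumLattice Literature.Probability.LatticeModels
open Literature.MathematicalPhysics.QuantumLattice.FermiRG
open Summit.HubbardSuperconductivity.HubbardSuperconductivity.Theorems.KLRegimeSplit
open Summit.HubbardSuperconductivity.HubbardSuperconductivity.Theorems.KLProgrammeLegKernels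
open Summit.HubbardSuperconductivity.HubbardSuperconductivity.Theorems.DispersionFlow

/-! ## §1 The dyadic layer cake for `Σ 1/ρ` -/

/-- **Dyadic layer cake.**  On a finite set where `m ≤ ρ ≤ Λ′` (`0 < m`, `Λ′ ≤ 2^{I+1}·m`):
`Σ_{p∈s} 1/ρ(p) ≤ Σ_{i=0}^{I} (2^{i+1}/Λ′)·#{p ∈ s : ρ(p) ≤ Λ′/2^i}` — every point is charged in the deepest dyadic layer containing it. -/
theorem sum_inv_le_dyadic {α : Type*} (s : Finset α) (ρ : α → ℝ) {Λ' m : ℝ} (hm : 0 < m) (I : ℕ) (hI : Λ' ≤ 2 ^ (I + 1) * m)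
    (hlo : ∀ p ∈ s, m ≤ ρ p) (hhi : ∀ p ∈ s, ρ p ≤ Λ') :
    ∑ p ∈ s, (ρ p)⁻¹ ≤ ∑ i ∈ range (I + 1), (2 : ℝ) ^ (i + 1) / Λ' * ((s.filter fun p => ρ p ≤ Λ' / 2 ^ i).card : ℝ) := by
  classical
  rcases s.eq_empty_or_nonempty with rfl | hne
  · simp
  · obtain ⟨p₀, hp₀⟩ := hne
    have hΛ' : 0 < Λ' := hm.trans_le ((hlo p₀ hp₀).trans (hhi p₀ hp₀))
    -- the deepest layer index of a point
    set ix : α → ℕ := fun p => Nat.findGreatest (fun i => ρ p ≤ Λ' / 2 ^ i) I with hix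
    have hixI : ∀ p, ix p ≤ I := fun p => Nat.findGreatest_le I
    have hixP : ∀ p ∈ s, ρ p ≤ Λ' / 2 ^ (ix p) := fun p hp =>
      Nat.findGreatest_spec (P := fun i => ρ p ≤ Λ' / 2 ^ i) (Nat.zero_le I) (by simpa using hhi p hp)
    -- the pointwise charge
    have hpt : ∀ p ∈ s, (ρ p)⁻¹ ≤ (2 : ℝ) ^ (ix p + 1) / Λ' := by
      intro p hp
      have hρ : 0 < ρ p := hm.trans_le (hlo p hp)
      rw [inv_eq_one_div, div_le_div_iff₀ hρ hΛ', one_mul]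
      -- `Λ′ ≤ 2^{ix+1}·ρ`: either `ix = I` (floor) or `ix < I` (maximality of the layer)
      rcases (hixI p).eq_or_lt with h | h
      · rw [h]
        calc Λ' ≤ 2 ^ (I + 1) * m := hI
          _ ≤ 2 ^ (I + 1) * ρ p := by gcongr; exact hlo p hp
      · have hnot : ¬ (ρ p ≤ Λ' / 2 ^ (ix p + 1)) :=
          Nat.findGreatest_is_greatest (P := fun i => ρ p ≤ Λ' / 2 ^ i) (Nat.lt_succ_self _) (Nat.succ_le_of_lt h)
        push Not at hnot
        rw [div_lt_iff₀ (by positivity)] at hnot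
        linarith
    -- sum fiberwise over the layer index
    have hmaps : ∀ p ∈ s, ix p ∈ range (I + 1) := fun p _ => mem_range.2 (Nat.lt_succ_of_le (hixI p))
    calc ∑ p ∈ s, (ρ p)⁻¹ ≤ ∑ p ∈ s, (2 : ℝ) ^ (ix p + 1) / Λ' := sum_le_sum hpt
      _ = ∑ i ∈ range (I + 1), ∑ p ∈ s with ix p = i, (2 : ℝ) ^ (ix p + 1) / Λ' := (sum_fiberwise_of_maps_to hmaps _).symm
      _ = ∑ i ∈ range (I + 1), (2 : ℝ) ^ (i + 1) / Λ' * ((s.filter fun p => ix p = i).card : ℝ) := by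
          refine sum_congr rfl fun i _ => ?_
          rw [sum_congr rfl fun p hp => by rw [(mem_filter.1 hp).2], sum_const, nsmul_eq_mul, mul_comm]
      _ ≤ ∑ i ∈ range (I + 1), (2 : ℝ) ^ (i + 1) / Λ' * ((s.filter fun p => ρ p ≤ Λ' / 2 ^ i).card : ℝ) := by
          refine sum_le_sum fun i _ => mul_le_mul_of_nonneg_left ?_ (by positivity)
          exact Nat.cast_le.2 (Finset.card_le_card fun p hp => by
            obtain ⟨hps, hpi⟩ := mem_filter.1 hp
            exact mem_filter.2 ⟨hps, hpi ▸ hixP p hps⟩)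

/-! ## §2 The disc count: frequencies times momenta -/

/-- `ω² + e² ≤ a²` (`0 ≤ a`) forces `|ω| ≤ a` and `|e| ≤ a`. -/
theorem abs_le_of_sq_add_sq_le {ω e a : ℝ} (ha : 0 ≤ a) (h : ω ^ 2 + e ^ 2 ≤ a ^ 2) : |ω| ≤ a ∧ |e| ≤ a :=
  ⟨abs_le_of_sq_le_sq' (by nlinarith [sq_nonneg e]) ha |> fun h => abs_le.2 h,
    abs_le_of_sq_le_sq' (by nlinarith [sq_nonneg ω]) ha |> fun h => abs_le.2 h⟩

/-- **The disc count**: `#{(ω,k̃) : ω² + e_K(p_k̃)² ≤ a² ∧ Q(k̃)} ≤ (aβ/π + 3)·#{k̃ : |e_K(p_k̃)| ≤ a ∧ Q(k̃)}` (`0 < β`, `0 ≤ a`). -/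
theorem card_disc_filter_le {L M : ℕ} [NeZero L] {β : ℝ} (hβ : 0 < β) (μ : ℝ) (K : TrigPolyC4v) {a : ℝ} (ha : 0 ≤ a) (Q : TorusSite 2 L → Prop)
    [DecidablePred Q] :
    ((univ.filter fun p : FreqMomentum L M => matsubaraFreq β M p.1 ^ 2 + nambuXiCT L μ K p.2 ^ 2 ≤ a ^ 2 ∧ Q p.2).card : ℝ) ≤
      (a * β / π + 3) * ((univ.filter fun k : TorusSite 2 L => |nambuXiCT L μ K k| ≤ a ∧ Q k).card : ℝ) := by
  classical
  set F := univ.filter fun i : MatsubaraIdx M => |matsubaraFreq β M i| ≤ a with hF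
  set G := univ.filter fun k : TorusSite 2 L => |nambuXiCT L μ K k| ≤ a ∧ Q k with hG
  have hsub : (univ.filter fun p : FreqMomentum L M => matsubaraFreq β M p.1 ^ 2 + nambuXiCT L μ K p.2 ^ 2 ≤ a ^ 2 ∧ Q p.2) ⊆ F ×ˢ G := by
    intro p hp
    obtain ⟨h1, h2⟩ := (mem_filter.1 hp).2
    obtain ⟨hω, he⟩ := abs_le_of_sq_add_sq_le ha h1
    exact mem_product.2 ⟨mem_filter.2 ⟨Finset.mem_univ _, hω⟩, mem_filter.2 ⟨Finset.mem_univ _, he, h2⟩⟩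
  have hFc : (F.card : ℝ) ≤ a * β / π + 3 := card_filter_matsubaraFreq_le hβ ha F fun i hi => (mem_filter.1 hi).2
  calc ((univ.filter fun p : FreqMomentum L M => matsubaraFreq β M p.1 ^ 2 + nambuXiCT L μ K p.2 ^ 2 ≤ a ^ 2 ∧ Q p.2).card : ℝ)
      ≤ ((F ×ˢ G).card : ℝ) := by exact_mod_cast Finset.card_le_card hsub
    _ = (F.card : ℝ) * (G.card : ℝ) := by rw [card_product]; push_cast; ring
    _ ≤ (a * β / π + 3) * (G.card : ℝ) := mul_le_mul_of_nonneg_right hFc (Nat.cast_nonneg _)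

/-! ## §3 The weighted two-shell mass -/

/-- Geometric sums of the dyadic radii: `Σ_{i ≤ I} Λ′/2^i ≤ 2Λ′` and `Σ_{i ≤ I} 2^i/Λ′ ≤ 2^{I+1}/Λ′` (`0 < Λ′`). -/
theorem dyadic_geom_sums {Λ' : ℝ} (hΛ' : 0 < Λ') (I : ℕ) :
    ∑ i ∈ range (I + 1), Λ' / 2 ^ i ≤ 2 * Λ' ∧ ∑ i ∈ range (I + 1), (2 : ℝ) ^ i / Λ' ≤ 2 ^ (I + 1) / Λ' := by
  constructor
  · have h : ∑ i ∈ range (I + 1), Λ' / 2 ^ i = Λ' * ∑ i ∈ range (I + 1), ((1 : ℝ) / 2) ^ i := by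
      rw [mul_sum]; refine sum_congr rfl fun i _ => ?_; rw [div_pow, one_pow]; ring
    rw [h, geom_sum_eq (by norm_num) (I + 1)]
    have h2 : 0 < ((1 : ℝ) / 2) ^ (I + 1) := by positivity
    have : (((1 : ℝ) / 2) ^ (I + 1) - 1) / (1 / 2 - 1) ≤ 2 := by
      rw [div_le_iff_of_neg (by norm_num)]; linarith
    nlinarith
  · have h : ∑ i ∈ range (I + 1), (2 : ℝ) ^ i / Λ' = (∑ i ∈ range (I + 1), (2 : ℝ) ^ i) / Λ' := by rw [sum_div]
    rw [h, geom_sum_eq (by norm_num) (I + 1)]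
    exact div_le_div_of_nonneg_right (by norm_num) hΛ'.le

/-- Summing the per-layer bounds (arithmetic): with `Σ Λ′/2^i ≤ 2Λ′`, `I + 1 ≤ x`, `Σ 2^i/Λ′ ≤ 2^{I+1}/Λ′ ≤ 2β/π`. -/
theorem sum_layers_le {A X δ β Λ' G x : ℝ} (hA : 0 ≤ A) (hX : 0 ≤ X) (hδ : 0 < δ) (hβ : 0 < β) (hΛ' : 0 < Λ') (hG : 0 ≤ G) (I : ℕ)
    (hI1 : (I : ℝ) + 1 ≤ x) (h2I : (2 : ℝ) ^ (I + 1) / Λ' ≤ 2 * β / π) :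
    ∑ i ∈ range (I + 1), 18 * A * X / δ ^ 2 * (2 * β / π * (Λ' / 2 ^ i) + (G * δ * β / π + 6) + 3 * G * δ * ((2 : ℝ) ^ i / Λ')) ≤
      18 * A * X / δ ^ 2 * (2 * β / π * (2 * Λ') + x * (G * δ * β / π + 6) + 3 * G * δ * (2 * β / π)) := by
  have hπ := Real.pi_pos
  have hgeo := dyadic_geom_sums hΛ' I
  rw [← mul_sum, sum_add_distrib, sum_add_distrib, ← mul_sum, ← mul_sum, sum_const, card_range, nsmul_eq_mul]
  push_cast
  have hc : 0 ≤ 18 * A * X / δ ^ 2 := by positivity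
  refine mul_le_mul_of_nonneg_left ?_ hc
  have h1 : 0 ≤ 2 * β / π := by positivity
  have h2 : 0 ≤ G * δ * β / π + 6 := by
    have : 0 ≤ G * δ * β / π := by positivity
    linarith
  have h3 : 0 ≤ 3 * G * δ := by positivity
  have t1 : 2 * β / π * ∑ i ∈ range (I + 1), Λ' / 2 ^ i ≤ 2 * β / π * (2 * Λ') := mul_le_mul_of_nonneg_left hgeo.1 h1
  have t2 : ((I : ℝ) + 1) * (G * δ * β / π + 6) ≤ x * (G * δ * β / π + 6) := mul_le_mul_of_nonneg_right hI1 h2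
  have t3 : 3 * G * δ * ∑ i ∈ range (I + 1), (2 : ℝ) ^ i / Λ' ≤ 3 * G * δ * (2 * β / π) := mul_le_mul_of_nonneg_left (hgeo.2.trans h2I) h3
  linarith

/-- The closed form (arithmetic): `x = Λ′β/π`, `δ = 2π/L`. -/
theorem layers_closed_form {A X β Λ' G L : ℝ} (hL : 0 < L) :
    18 * A * X / (2 * π / L) ^ 2 * (2 * β / π * (2 * Λ') + Λ' * β / π * (G * (2 * π / L) * β / π + 6) + 3 * G * (2 * π / L) * (2 * β / π)) =
      9 * A * L ^ 2 / (2 * π ^ 2) * X * (β * Λ' / π * (10 + 2 * G * β / L) + 12 * G * β / L) := by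
  have hπ := Real.pi_pos.ne'
  field_simp
  ring

/-- **THE WEIGHTED LATTICE TWO-SHELL MASS.**  For a two-shell area package `TwoShellFrameAreaAt A u` (`0 ≤ A`), `R.WF2`, `0 < U ≤ u R`, `μ ∈ klWindowC`,
`FrameOK R U N μ K`, `0 < β`, a disc radius `0 < Λ′` with `2Λ′ ≤ ε₂`, `ε₂ + G·2π/L ≤ klE0` (`G = 4 + (8/3)·Gfr₁·U²`), and a lattice transfer `w̃` with
`0 < r ≤ |p_w̃|_𝕋`:
`Σ_{(ω,k̃) : ω² + e_K(p_k̃)² ≤ Λ′², |e_K(p_{k̃−w̃})| ≤ ε₂} (ω² + e_K(p_k̃)²)^{-1/2} ≤ (9AL²/(2π²))·((ε₂+Gδ)/r + √(ε₂+Gδ))·[(βΛ′/π)(10 + 2Gβ/L) + 12Gβ/L]`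
(`δ = 2π/L`; β-uniform: no `log β`). [cite: FeldmanSalmhoferTrubowitz1998, App. B] -/
theorem twoShell_weighted_sum_le {A : ℝ} {u : RenConsts → ℝ} (h : TwoShellFrameAreaAt A u) (hA : 0 ≤ A) {R : RenConsts} (hR : R.WF2)
    {U : ℝ} (hU : 0 < U) (hUu : U ≤ u R) {μ : ℝ} (hμ : μ ∈ klWindowC) {N : ℕ} {K : TrigPolyC4v} (hK : FrameOK R U N μ K)
    {L M : ℕ} [NeZero L] [NeZero M] {β : ℝ} (hβ : 0 < β) {Λ' ε₂ : ℝ} (hΛ' : 0 < Λ') (h2Λ : 2 * Λ' ≤ ε₂)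
    (h2 : ε₂ + (4 + 8 / 3 * R.Gfr 1 * U ^ 2) * (2 * π / L) ≤ klE0) (wt : TorusSite 2 L) {r : ℝ} (hr : 0 < r) (hrw : r ≤ klTorusNorm L wt) :
    ∑ p ∈ univ.filter (fun p : FreqMomentum L M => matsubaraFreq β M p.1 ^ 2 + nambuXiCT L μ K p.2 ^ 2 ≤ Λ' ^ 2 ∧ |nambuXiCT L μ K (p.2 - wt)| ≤ ε₂),
        (Real.sqrt (matsubaraFreq β M p.1 ^ 2 + nambuXiCT L μ K p.2 ^ 2))⁻¹ ≤
      9 * A * (L : ℝ) ^ 2 / (2 * π ^ 2) *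
        ((ε₂ + (4 + 8 / 3 * R.Gfr 1 * U ^ 2) * (2 * π / L)) / r + Real.sqrt (ε₂ + (4 + 8 / 3 * R.Gfr 1 * U ^ 2) * (2 * π / L))) *
        (β * Λ' / π * (10 + 2 * (4 + 8 / 3 * R.Gfr 1 * U ^ 2) * β / L) + 12 * (4 + 8 / 3 * R.Gfr 1 * U ^ 2) * β / L) := by
  classical
  have hπ := Real.pi_pos
  have hL : (0 : ℝ) < L := by exact_mod_cast Nat.pos_of_ne_zero (NeZero.ne L)
  have hGfr : ∀ j, 0 ≤ R.Gfr j := hR.wf.2.2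
  set G : ℝ := 4 + 8 / 3 * R.Gfr 1 * U ^ 2 with hG
  have hG0 : 0 ≤ G := by rw [hG]; nlinarith [hGfr 1, sq_nonneg U]
  set δ : ℝ := 2 * π / L with hδ
  have hδ0 : 0 < δ := by rw [hδ]; positivity
  set X : ℝ := (ε₂ + G * δ) / r + Real.sqrt (ε₂ + G * δ) with hX
  have hε₂0 : 0 < ε₂ := by linarith
  have hX0 : 0 ≤ X := by rw [hX]; positivity
  set ρ : FreqMomentum L M → ℝ := fun p => Real.sqrt (matsubaraFreq β M p.1 ^ 2 + nambuXiCT L μ K p.2 ^ 2) with hρ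
  set s := univ.filter (fun p : FreqMomentum L M => matsubaraFreq β M p.1 ^ 2 + nambuXiCT L μ K p.2 ^ 2 ≤ Λ' ^ 2 ∧ |nambuXiCT L μ K (p.2 - wt)| ≤ ε₂)
    with hs
  -- the floor `π/β ≤ ρ` and the top `ρ ≤ Λ′` on `s`
  have hlo : ∀ p ∈ s, π / β ≤ ρ p := fun p _ =>
    (pi_div_le_abs_matsubaraFreq hβ p.1).trans (Real.abs_le_sqrt (by nlinarith [sq_nonneg (nambuXiCT L μ K p.2)]))
  have hhi : ∀ p ∈ s, ρ p ≤ Λ' := fun p hp => by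
    have h1 := ((mem_filter.1 hp).2).1
    calc ρ p ≤ Real.sqrt (Λ' ^ 2) := Real.sqrt_le_sqrt h1
      _ = Λ' := Real.sqrt_sq hΛ'.le
  -- the right-hand side is nonnegative
  have hrhs : 0 ≤ 9 * A * (L : ℝ) ^ 2 / (2 * π ^ 2) * X * (β * Λ' / π * (10 + 2 * G * β / L) + 12 * G * β / L) := by positivity
  -- the empty case `Λ′ < π/β`
  by_cases hsmall : Λ' < π / β
  · have hs0 : s = ∅ := by
      refine eq_empty_of_forall_notMem fun p hp => ?_
      have := (hlo p hp).trans (hhi p hp)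
      linarith
    change ∑ p ∈ s, (ρ p)⁻¹ ≤ _
    rw [hs0, sum_empty]
    exact hrhs
  push Not at hsmall
  -- the number of layers: `2^I ≤ Λ′β/π < 2^{I+1}`
  set x : ℝ := Λ' * β / π with hx
  have hx1 : 1 ≤ x := by rw [hx, le_div_iff₀ hπ, one_mul]; rw [div_le_iff₀ hβ] at hsmall; linarith
  set Nn : ℕ := ⌊x⌋₊ with hNn
  have hNn1 : 1 ≤ Nn := by rw [hNn]; exact Nat.one_le_floor_iff _ |>.2 hx1
  set I : ℕ := Nat.log 2 Nn with hI
  have hIlo : (2 : ℝ) ^ I ≤ x := by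
    have h1 : (2 : ℕ) ^ I ≤ Nn := Nat.pow_log_le_self 2 (by omega)
    have h2 : ((2 : ℕ) ^ I : ℝ) ≤ (Nn : ℝ) := by exact_mod_cast h1
    push_cast at h2
    exact h2.trans (Nat.floor_le (by linarith))
  have hIhi : x ≤ (2 : ℝ) ^ (I + 1) := by
    have h1 : Nn < 2 ^ (I + 1) := Nat.lt_pow_succ_log_self one_lt_two Nn
    have h2 : (Nn : ℝ) + 1 ≤ ((2 : ℕ) ^ (I + 1) : ℕ) := by exact_mod_cast h1
    push_cast at h2
    exact (Nat.lt_floor_add_one x).le.trans h2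
  have hIm : Λ' ≤ 2 ^ (I + 1) * (π / β) := by
    have : x * (π / β) = Λ' := by rw [hx]; field_simp
    rw [← this]; exact mul_le_mul_of_nonneg_right hIhi (by positivity)
  -- step 1: the layer cake
  have step1 := sum_inv_le_dyadic s ρ (by positivity : 0 < π / β) I hIm hlo hhi
  -- step 2: each layer count
  have hcount : ∀ i ∈ range (I + 1), ((s.filter fun p => ρ p ≤ Λ' / 2 ^ i).card : ℝ) ≤
      (Λ' / 2 ^ i * β / π + 3) * (9 * A * (2 * (Λ' / 2 ^ i) + G * δ) * X / δ ^ 2) := by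
    intro i _
    set a : ℝ := Λ' / 2 ^ i with ha
    have ha0 : 0 < a := by rw [ha]; positivity
    have haΛ : a ≤ Λ' := by
      rw [ha, div_le_iff₀ (by positivity)]
      have : (1 : ℝ) ≤ 2 ^ i := one_le_pow₀ (by norm_num)
      nlinarith
    -- (i) into the disc filter
    have hsub : (s.filter fun p => ρ p ≤ a) ⊆ univ.filter (fun p : FreqMomentum L M =>
        matsubaraFreq β M p.1 ^ 2 + nambuXiCT L μ K p.2 ^ 2 ≤ a ^ 2 ∧ |nambuXiCT L μ K (p.2 - wt)| ≤ ε₂) := by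
      intro p hp
      obtain ⟨hps, hpa⟩ := mem_filter.1 hp
      obtain ⟨-, hQ⟩ := (mem_filter.1 hps).2
      refine mem_filter.2 ⟨Finset.mem_univ _, ?_, hQ⟩
      have h0 : 0 ≤ matsubaraFreq β M p.1 ^ 2 + nambuXiCT L μ K p.2 ^ 2 := by positivity
      have := Real.sq_sqrt h0
      have hρ0 : 0 ≤ ρ p := Real.sqrt_nonneg _
      nlinarith
    have c1 : ((s.filter fun p => ρ p ≤ a).card : ℝ) ≤ ((univ.filter (fun p : FreqMomentum L M =>
        matsubaraFreq β M p.1 ^ 2 + nambuXiCT L μ K p.2 ^ 2 ≤ a ^ 2 ∧ |nambuXiCT L μ K (p.2 - wt)| ≤ ε₂)).card : ℝ) :=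
      Nat.cast_le.2 (Finset.card_le_card hsub)
    -- (ii) disc count = frequencies × momenta
    have c2 := card_disc_filter_le (M := M) hβ μ K ha0.le (fun k : TorusSite 2 L => |nambuXiCT L μ K (k - wt)| ≤ ε₂)
    -- (iii) the momentum count by the lattice two-shell count at `ε₁ = 2a`
    have hsub2 : (univ.filter fun k : TorusSite 2 L => |nambuXiCT L μ K k| ≤ a ∧ |nambuXiCT L μ K (k - wt)| ≤ ε₂) ⊆
        univ.filter fun k : TorusSite 2 L => |nambuXiCT L μ K k| < 2 * a ∧ |nambuXiCT L μ K (k - wt)| ≤ ε₂ := by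
      intro k hk
      obtain ⟨h1, h2⟩ := (mem_filter.1 hk).2
      exact mem_filter.2 ⟨Finset.mem_univ _, by linarith, h2⟩
    have c3 := card_twoShell_mul_sq_le h hA hR hU hUu hμ hK (by positivity : 0 < 2 * a) (by linarith) h2 wt hr hrw
    have c3' : ((univ.filter fun k : TorusSite 2 L => |nambuXiCT L μ K k| ≤ a ∧ |nambuXiCT L μ K (k - wt)| ≤ ε₂).card : ℝ) ≤
        9 * A * (2 * a + G * δ) * X / δ ^ 2 := by
      rw [le_div_iff₀ (by positivity)]
      refine le_trans ?_ (c3.trans (le_of_eq (by rw [hX, hG, hδ]; ring)))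
      exact mul_le_mul_of_nonneg_right (Nat.cast_le.2 (Finset.card_le_card hsub2)) (by positivity)
    calc ((s.filter fun p => ρ p ≤ a).card : ℝ) ≤ _ := c1
      _ ≤ (a * β / π + 3) * _ := c2
      _ ≤ (a * β / π + 3) * (9 * A * (2 * a + G * δ) * X / δ ^ 2) := mul_le_mul_of_nonneg_left c3' (by positivity)
  -- step 3: sum the layers
  have step3 : ∑ i ∈ range (I + 1), (2 : ℝ) ^ (i + 1) / Λ' * ((s.filter fun p => ρ p ≤ Λ' / 2 ^ i).card : ℝ) ≤
      ∑ i ∈ range (I + 1), 18 * A * X / δ ^ 2 * (2 * β / π * (Λ' / 2 ^ i) + (G * δ * β / π + 6) + 3 * G * δ * ((2 : ℝ) ^ i / Λ')) := by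
    refine sum_le_sum fun i hi => ?_
    have hpos : 0 ≤ (2 : ℝ) ^ (i + 1) / Λ' := by positivity
    refine (mul_le_mul_of_nonneg_left (hcount i hi) hpos).trans (le_of_eq ?_)
    have h2i : (2 : ℝ) ^ i ≠ 0 := by positivity
    field_simp
    ring
  have hI1 : ((I : ℝ) + 1) ≤ x := by
    have h1 : (I : ℝ) + 1 ≤ (2 : ℝ) ^ I := by exact_mod_cast Nat.lt_two_pow_self
    exact h1.trans hIlo
  have h2I : (2 : ℝ) ^ (I + 1) / Λ' ≤ 2 * β / π := by
    rw [div_le_iff₀ hΛ', pow_succ]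
    have : (2 : ℝ) ^ I * 2 ≤ x * 2 := by linarith [hIlo]
    rw [hx] at this
    calc (2 : ℝ) ^ I * 2 ≤ Λ' * β / π * 2 := this
      _ = 2 * β / π * Λ' := by ring
  have step4 := sum_layers_le hA hX0 hδ0 hβ hΛ' hG0 I hI1 h2I
  have final := layers_closed_form (A := A) (X := X) (β := β) (Λ' := Λ') (G := G) hL
  rw [hx] at step4
  rw [← hδ] at final
  exact step1.trans (step3.trans (step4.trans final.le))

/-- **The package instance** (`A = klTS`, `u = klTSU`): the weighted lattice two-shell mass for every admissible frame below `klTSU`. -/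
theorem twoShell_weighted_sum_le_klTS {R : RenConsts} (hR : R.WF2) {U : ℝ} (hU : 0 < U) (hUu : U ≤ klTSU R) {μ : ℝ} (hμ : μ ∈ klWindowC)
    {N : ℕ} {K : TrigPolyC4v} (hK : FrameOK R U N μ K) {L M : ℕ} [NeZero L] [NeZero M] {β : ℝ} (hβ : 0 < β) {Λ' ε₂ : ℝ} (hΛ' : 0 < Λ')
    (h2Λ : 2 * Λ' ≤ ε₂) (h2 : ε₂ + (4 + 8 / 3 * R.Gfr 1 * U ^ 2) * (2 * π / L) ≤ klE0) (wt : TorusSite 2 L) {r : ℝ} (hr : 0 < r)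
    (hrw : r ≤ klTorusNorm L wt) :
    ∑ p ∈ univ.filter (fun p : FreqMomentum L M => matsubaraFreq β M p.1 ^ 2 + nambuXiCT L μ K p.2 ^ 2 ≤ Λ' ^ 2 ∧ |nambuXiCT L μ K (p.2 - wt)| ≤ ε₂),
        (Real.sqrt (matsubaraFreq β M p.1 ^ 2 + nambuXiCT L μ K p.2 ^ 2))⁻¹ ≤
      9 * klTS * (L : ℝ) ^ 2 / (2 * π ^ 2) *
        ((ε₂ + (4 + 8 / 3 * R.Gfr 1 * U ^ 2) * (2 * π / L)) / r + Real.sqrt (ε₂ + (4 + 8 / 3 * R.Gfr 1 * U ^ 2) * (2 * π / L))) *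
        (β * Λ' / π * (10 + 2 * (4 + 8 / 3 * R.Gfr 1 * U ^ 2) * β / L) + 12 * (4 + 8 / 3 * R.Gfr 1 * U ^ 2) * β / L) :=
  twoShell_weighted_sum_le twoShellFrameAreaAt_klTS klTS_nonneg hR hU hUu hμ hK hβ hΛ' h2Λ h2 wt hr hrw

end Summit.HubbardSuperconductivity.HubbardSuperconductivity.Theorems.EngineV8

end
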